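import Summits.BirchSwinnertonDyer.BirchSwinnertonDyer.Theorems.ClassRecordThreeEulerHalvesAtThreeKolyImageOrderEntryEndShiftDiv
import Summits.BirchSwinnertonDyer.BirchSwinnertonDyer.Theorems.ClassRecordThreeCornerAtThreeKolyImageIndexFormGenericEnd
import HarnessLib
/-!
# The IMAGE-KEYED Kolyvagin ORDER machine WITH GLOBAL DIVISIBILITY (D5 of the «SHIFT×DIV» merge): INDEX FORM —
# `ord_p #Ш(E/K)[p^∞] + 2t ≤ 2·ord_p[E(K):ℤP]` for a point carrying a depth-`k` ring-class-rational Euler system whose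
# derived classes are killed by `p^{M−t}` (crux `EulerHalvesAtThree`, item stmt-BirchSwinnertonDyer-19109, road to DERIVE the
# r3 stub `stub_inertSavingDisplayAtThree`; cell `bsd-stepL`, seat `bsd-stepL-tam3-p1` g11; `--supports … --as helper`)

HONEST FRAMING: ONE THEOREM (no definition, no named fact, no `sorry`); nothing here is a BSD class theorem; no census label
moves (T7); item 19109 is NOT closed; CONDITIONAL on the displayed binders exactly as the parents. BSD is not proved by any of this.

## THIS FILE (series rationale in D1 `…KolyImageOrderBoundShiftDiv.lean`)
`padicValNat_card_sha_primary_add_le_of_ringClassRationalPointsMDiv_shift_of_poitouTate_of_localDuality_ofImage` — the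
McCallum-Cor.-5.6-under-global-divisibility shape («ord_p #Ш + 2t ≤ 2M₀», the order clause of r3's
`stub_inertSavingDisplayAtThree`) for ANY point `P` of finite index carrying a Div-carrier. WHAT IS LEFT for the display
(successor files D6 ∕ D7): the Div-carrier FROM THE SHIMURA LABELS — corner3-p2's image-free carrier
`hpointsRk_of_shimuraLabels_of_noTorsion` (K4e) with the divisibility conjunct derived from a LABEL-SIDE global divisibility of
the derived CM points (McCallum Cor. 4.5 in class form, as in tam3-p1 g9's `…KolyvaginShaOrderDivisibleEnd`) — and the display
assembly (twin of `…CornerAtThreeShimuraInertDisplayOfPrimitives` ∕ `…EulerHalvesAtThreeInertDisplayOfPrimitives`).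
[cite: McCallumLMS1991, §1 Theorem (Kolyvagin), §4 Cor. 4.5, §5 Lemma 5.1, Cor. 5.6] [cite: Jetchev2008, p. 812 (1), Cor. 1.5]
[cite: GrossLMS1991, §2 Thm. 2.2 (2)] [cite: MilneADT2006, Ch. I Thm. 4.10(b), §6 Thm. 6.13(a)]
presearch: as the parents (bookkeeping merge).
-/

noncomputable section

open scoped Classical AddSubgroup
set_option linter.dupNamespace false

universe u

namespace Summit.BirchSwinnertonDyer.BirchSwinnertonDyer.Theorems.ShimuraKolyvaginOfImage

open Summit.BirchSwinnertonDyer.BirchSwinnertonDyer.Theorems.ShimuraKolyvaginLocalShift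
open WeierstrassCurve NumberField IsDedekindDomain Field Function
  Literature.NumberTheory.EllipticCurves Literature.NumberTheory.EllipticCurves.KolyvaginCocycle
  Literature.NumberTheory.EllipticCurves.KolyvaginDescent
  Literature.NumberTheory.EllipticCurves.RingClassField
  Literature.NumberTheory.GaloisRepresentations Literature.NumberTheory.GaloisCohomology
  Literature.NumberTheory.NumberFields Literature.NumberTheory.DiophantineGeometry
  Summit.BirchSwinnertonDyer.Rank1Residual.X11b
  Summit.BirchSwinnertonDyer.BirchSwinnertonDyer.Theorems
  Summit.BirchSwinnertonDyer.BirchSwinnertonDyer.Theorems.ShimuraKolyvaginOrder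
open Literature.NumberTheory.GaloisRepresentations.DiscreteGaloisModule (mu MuCarrier)


variable {K : Type} [Field K] [NumberField K]

/-- **INDEX form, `p` odd, image inputs, REFINED BY GLOBAL DIVISIBILITY: `ord_p #Ш(E/K)[p^∞] + 2t ≤ 2·ord_p[E(K):ℤP]`** for a
point `P` of finite index carrying the depth-`k` ring-class-rational Euler system `hpointsRk` WHOSE DERIVED CLASSES ARE KILLED
BY `p^{M−t}` (the divisibility conjunct of D4), from Poitou–Tate and the Cassels–Tate inputs at level `p^{M₀}`,
`M₀ = ord_p[E(K):ℤP]` — corner3-p2 g5's `natCard_sha_primary_le_pow_index_of_ringClassRationalPointsM_shift_…_ofImage`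
(`…KolyImageIndexFormGenericEnd.lean`) with the divisibility threaded: `M₀ ≥ 1` is D4's
`card_sha_primary_le_of_ringClassRationalPointsMDiv_shift_of_poitouTate_of_localDuality_ofImage` after McCallum's Lemma 5.1;
`M₀ = 0` is the parents' END (`Ш(E/K)[p^∞] = 0`) together with `t = 0`, read off the divisibility at `m = 1`, level `p`
(`δ_p P = 0 ⟹ P ∈ pE(K)`, `kummerMapTorsion_ker`, contradicting `p ∤ [E(K):ℤP]`). NO clause on `E`.
[cite: McCallumLMS1991, §1 Theorem (Kolyvagin), Lemma 5.1, Cor. 5.6] [cite: Jetchev2008, p. 812 (1) and Cor. 1.5]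
[cite: GrossLMS1991, §2 Thm. 2.2 (2)] [cite: MilneADT2006, Ch. I Thm. 4.10(b), §6 Thm. 6.13(a)] -/
theorem padicValNat_card_sha_primary_add_le_of_ringClassRationalPointsMDiv_shift_of_poitouTate_of_localDuality_ofImage
    (hPT : poitouTate_sum_localTatePairing_eq_zero K)
    (W : WeierstrassCurve ℚ) [W.IsElliptic] [W.IsGloballyMinimal] {N : ℕ} [NeZero N]
    (hN : W.conductorNorm ℤ = N) {p : ℕ} [Fact p.Prime] (hp2 : p ≠ 2) (hIz : ∃ z : Field.absoluteGaloisGroup K, ∀ t : geomTorsion (W.baseChange K) p, z • t = -t)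
    (hIs : (W.baseChange K).HasIrreducibleModPGaloisRep p)
    (hIc : ∀ f : geomTorsion (W.baseChange K) p →+ geomTorsion (W.baseChange K) p,
      (∀ (g : Field.absoluteGaloisGroup K) (t : geomTorsion (W.baseChange K) p), f (g • t) = g • f t) →
        ∃ k : ℤ, ∀ t, f t = k • t)
    (hIt : AddSubgroup.torsionBy (W.baseChange K).toAffine.Point (p : ℤ) = ⊥)
    (hK : IsImaginaryQuadratic K)
    (ι : K →+* ℂ) {S : Finset ℕ}
    (hin : ∀ ℓ ∈ S, ℓ.Prime ∧ ℓ ∣ N ∧ ¬ ℓ ^ 2 ∣ N ∧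
      ((Ideal.span {(ℓ : ℤ)}).primesOver (𝓞 K)).ncard = 1 ∧ ¬ (ℓ : ℤ) ∣ NumberField.discr K)
    (hsp : ∀ ℓ : ℕ, ℓ.Prime → ℓ ∣ N → ℓ ∉ S → ((Ideal.span {(ℓ : ℤ)}).primesOver (𝓞 K)).ncard = 2)
    {P : (W.baseChange K).toAffine.Point} (hnt : ¬ IsOfFinAddOrder P)
    (hidx0 : 0 < (AddSubgroup.zmultiples P).index) {M₀ : ℕ}
    (hv : padicValNat p (AddSubgroup.zmultiples P).index = M₀) [NeZero (p ^ M₀)]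
    {c : K ≃ₐ[ℚ] K} (hc : c ≠ 1) (hcc : c * c = 1)
    (t : ℕ)
    (hpointsRk : ∀ (k : ℕ) {M : ℕ} (_hM : 1 ≤ M)
      (hdiv : ∀ Q : geomPoints (W.baseChange K), ∃ R, ((p ^ M : ℕ) : ℤ) • R = Q)
      (c : K ≃ₐ[ℚ] K) (_hc : c ≠ 1),
      ∃ (ε : ℤ) (τ : AlgebraicClosure K ≃+* AlgebraicClosure K) (hτ : IsLiftOfAut c τ)
        (A : ℕ → AddSubgroup (geomPoints (W.baseChange K)))
        (hA : ∀ m, KolyvaginCocycle.IsAdmissible (Field.absoluteGaloisGroup K) (A m)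
          ((p ^ M : ℕ) : ℤ))
        (emb : ∀ m : ℕ, ringClassField K ι m →ₐ[K] AlgebraicClosure K)
        (Pt : ℕ → geomPoints (W.baseChange K))
        (hPt : ∀ m, Pt m ∈
          KolyvaginCocycle.invPoints (Field.absoluteGaloisGroup K) (A m) ((p ^ M : ℕ) : ℤ)),
        (ε = 1 ∨ ε = -1) ∧
        IsOfFinAddOrder (Affine.Point.map (W' := W) (c : K →ₐ[ℚ] K) P - ε • P) ∧
        (∀ m, ∀ a ∈ A m, hτ.pointsMap W a ∈ A m) ∧
        Pt 1 = toGeomPoints (W.baseChange K) P ∧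
        (∀ m, m ≠ 0 → ∀ a ∈ A m, ∀ Φ : Field.absoluteGaloisGroup K,
          (∀ x : ringClassField K ι m, Φ • emb m x = emb m x) → Φ • a = a) ∧
        (∀ m, KolyvaginCocycle.IsAdmissible (Field.absoluteGaloisGroup K) (A m)
          ((p ^ (M + k) : ℕ) : ℤ)) ∧
        (∀ m : ℕ, Squarefree m →
          (∀ q ∈ m.primeFactors, IsKolyvaginPrime N W K p q ∧ FrobEqFrobInfty W K (p ^ (M + k)) q) →
          Pt m ∈ KolyvaginCocycle.invPoints (Field.absoluteGaloisGroup K) (A m)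
            ((p ^ (M + k) : ℕ) : ℤ) ∧
          (∃ B ∈ A m, hτ.pointsMap W (Pt m) =
            (ε * (-1) ^ m.primeFactors.card) • Pt m + ((p ^ M : ℕ) : ℤ) • B) ∧
          (∀ ℓ : ℕ, ℓ.Prime → ℓ ∣ m → ∀ v : HeightOneSpectrum (𝓞 K), (ℓ : 𝓞 K) ∈ v.asIdeal →
            ∀ a : ℕ, (((p : ℤ) ^ a) •
                kolyvaginClass (W.baseChange K) _ hdiv (hA m) (Pt m) (hPt m) ∈
                selmerLocalKer (W.baseChange K) (v.adicCompletion K) ((p ^ M : ℕ) : ℤ) ↔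
              ((p : ℤ) ^ a) • kolyvaginClass (W.baseChange K) _ hdiv (hA (m / ℓ)) (Pt (m / ℓ))
                  (hPt (m / ℓ)) ∈
                (W.baseChange K).torsionLocalKer (v.adicCompletion K) ((p ^ M : ℕ) : ℤ))) ∧
          -- GLOBAL DIVISIBILITY to depth `t`: the class of `P_m` is killed by `p^{M−t}`
          ((p : ℤ) ^ (M - t)) • kolyvaginClass (W.baseChange K) _ hdiv (hA m) (Pt m) (hPt m) = 0))
    (e : geomTorsion (W.baseChange K) ((p ^ M₀ * p ^ M₀ : ℕ) : ℤ) →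
      geomTorsion (W.baseChange K) ((p ^ M₀ * p ^ M₀ : ℕ) : ℤ) → AlgebraicClosure K)
    (hμ : ∀ S T, e S T ^ (p ^ M₀ * p ^ M₀) = 1)
    (hadd₁ : ∀ S₁ S₂ T, e (S₁ + S₂) T = e S₁ T * e S₂ T)
    (hadd₂ : ∀ S T₁ T₂, e S (T₁ + T₂) = e S T₁ * e S T₂)
    (hgal : ∀ (σ : absoluteGaloisGroup K) (S T : geomTorsion (W.baseChange K) ((p ^ M₀ * p ^ M₀ : ℕ) : ℤ)),
      σ • e S T = e (σ • S) (σ • T))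
    (halt : ∀ T, e T T = 1) (hnondeg : ∀ T, (∀ S, e S T = 1) → T = 0)
    (inv : LocalInvariants K (p ^ M₀ * p ^ M₀)) (hPT' : inv.SumInvLocalizationEqZero)
    (hinv : ∀ v : HeightOneSpectrum (𝓞 K), Injective (inv (Sum.inr v)))
    (hH3 : ∀ x : galoisCohomology (mu K (p ^ M₀ * p ^ M₀)) 3,
      (∀ v : Place K, galoisCohomology.localization (mu K (p ^ M₀ * p ^ M₀)) v 3 x = 0) → x = 0)
    (hB : Literature.GroupTheory.FiniteAbelian.IsLevelPairing (p ^ M₀)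
      (ctLevelPairing (W.baseChange K) (p ^ M₀) e hμ hadd₁ hadd₂ hgal inv halt hPT' hH3
        (localTerm_finite_support (W := W.baseChange K) (m := p ^ M₀) (e := e) (hμ := hμ)
          (hadd₁ := hadd₁) (hadd₂ := hadd₂) (hgal := hgal) halt inv)))
    (hPτ : ∀ z ∈ selmerGroup (W.baseChange K) ((p ^ M₀ * p ^ M₀ : ℕ) : ℤ),
      ∀ t ∈ selmerGroup (W.baseChange K) ((p ^ M₀ * p ^ M₀ : ℕ) : ℤ),
      ctGeneralFun (W.baseChange K) (p ^ M₀) e hμ hadd₁ hadd₂ hgal inv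
          (torsionH1ToH1 (W.baseChange K) _ (conjAct W c _ z))
          (torsionH1ToH1 (W.baseChange K) _ (conjAct W c _ t)) =
        ctGeneralFun (W.baseChange K) (p ^ M₀) e hμ hadd₁ hadd₂ hgal inv
          (torsionH1ToH1 (W.baseChange K) _ z) (torsionH1ToH1 (W.baseChange K) _ t)) :
    padicValNat p (Nat.card (AddCommGroup.primaryComponent (W.baseChange K).sha p)) + 2 * t ≤
      2 * padicValNat p (AddSubgroup.zmultiples P).index := by
  haveI : (W.baseChange K).IsElliptic := inferInstanceAs (W.map (algebraMap ℚ K)).IsElliptic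
  have hp : p.Prime := Fact.out
  -- `E(K)[p] = 0`
  have hbot := hIt
  have hAp : ∀ a : (W.baseChange K).toAffine.Point, ((p : ℕ) : ℤ) • a = 0 → a = 0 := fun a ha ↦ by
    have : a ∈ AddSubgroup.torsionBy (W.baseChange K).toAffine.Point ((p : ℕ) : ℤ) := by
      rw [mem_torsionBy_iff]; exact ha
    rw [hbot] at this
    exact this
  -- McCallum Lemma 5.1: `ord_p [E(K) : ℤP] = M₀ ⟺ p^{M₀} ∥ P`
  obtain ⟨⟨x₀, hx₀⟩, hmax'⟩ :=
    Summit.BirchSwinnertonDyer.Rank1Residual.Additive.zsmul_certificate_of_padicValNat_index hp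
      hAp hnt hidx0.ne' hv
  -- the unrefined carrier (drop the divisibility conjunct), for the `M₀ = 0` END
  have hpointsRk' : ∀ (k : ℕ) {M : ℕ} (_hM : 1 ≤ M)
      (hdiv : ∀ Q : geomPoints (W.baseChange K), ∃ R, ((p ^ M : ℕ) : ℤ) • R = Q)
      (c : K ≃ₐ[ℚ] K) (_hc : c ≠ 1),
      ∃ (ε : ℤ) (τ : AlgebraicClosure K ≃+* AlgebraicClosure K) (hτ : IsLiftOfAut c τ)
        (A : ℕ → AddSubgroup (geomPoints (W.baseChange K)))
        (hA : ∀ m, KolyvaginCocycle.IsAdmissible (Field.absoluteGaloisGroup K) (A m)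
          ((p ^ M : ℕ) : ℤ))
        (emb : ∀ m : ℕ, ringClassField K ι m →ₐ[K] AlgebraicClosure K)
        (Pt : ℕ → geomPoints (W.baseChange K))
        (hPt : ∀ m, Pt m ∈
          KolyvaginCocycle.invPoints (Field.absoluteGaloisGroup K) (A m) ((p ^ M : ℕ) : ℤ)),
        (ε = 1 ∨ ε = -1) ∧
        IsOfFinAddOrder (Affine.Point.map (W' := W) (c : K →ₐ[ℚ] K) P - ε • P) ∧
        (∀ m, ∀ a ∈ A m, hτ.pointsMap W a ∈ A m) ∧
        Pt 1 = toGeomPoints (W.baseChange K) P ∧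
        (∀ m, m ≠ 0 → ∀ a ∈ A m, ∀ Φ : Field.absoluteGaloisGroup K,
          (∀ x : ringClassField K ι m, Φ • emb m x = emb m x) → Φ • a = a) ∧
        (∀ m, KolyvaginCocycle.IsAdmissible (Field.absoluteGaloisGroup K) (A m)
          ((p ^ (M + k) : ℕ) : ℤ)) ∧
        (∀ m : ℕ, Squarefree m →
          (∀ q ∈ m.primeFactors, IsKolyvaginPrime N W K p q ∧ FrobEqFrobInfty W K (p ^ (M + k)) q) →
          Pt m ∈ KolyvaginCocycle.invPoints (Field.absoluteGaloisGroup K) (A m)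
            ((p ^ (M + k) : ℕ) : ℤ) ∧
          (∃ B ∈ A m, hτ.pointsMap W (Pt m) =
            (ε * (-1) ^ m.primeFactors.card) • Pt m + ((p ^ M : ℕ) : ℤ) • B) ∧
          (∀ ℓ : ℕ, ℓ.Prime → ℓ ∣ m → ∀ v : HeightOneSpectrum (𝓞 K), (ℓ : 𝓞 K) ∈ v.asIdeal →
            ∀ a : ℕ, (((p : ℤ) ^ a) •
                kolyvaginClass (W.baseChange K) _ hdiv (hA m) (Pt m) (hPt m) ∈
                selmerLocalKer (W.baseChange K) (v.adicCompletion K) ((p ^ M : ℕ) : ℤ) ↔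
              ((p : ℤ) ^ a) • kolyvaginClass (W.baseChange K) _ hdiv (hA (m / ℓ)) (Pt (m / ℓ))
                  (hPt (m / ℓ)) ∈
                (W.baseChange K).torsionLocalKer (v.adicCompletion K) ((p ^ M : ℕ) : ℤ)))) := by
    intro k M hM hdiv c hc
    obtain ⟨ε, τ, hτ, A, hA, emb, Pt, hPt, hε, h53, hAτ, hPt1, hrat, hAk, hm'⟩ := hpointsRk k hM hdiv c hc
    exact ⟨ε, τ, hτ, A, hA, emb, Pt, hPt, hε, h53, hAτ, hPt1, hrat, hAk, fun m hm hk ↦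
      ⟨(hm' m hm hk).1, (hm' m hm hk).2.1, (hm' m hm hk).2.2.1⟩⟩
  rcases Nat.eq_zero_or_pos M₀ with h0 | hpos
  · -- `M₀ = 0`: `Ш(E/K)[p^∞] = 0` by the parents' END, and `t = 0` by the divisibility at `m = 1`, level `p`
    subst h0
    have hcard := natCard_primaryComponent_sha_le_of_ringClassRationalPointsM_shift_of_poitouTate_ofImage hPT W hN hp2
      hIz hIs hIc hIt hK ι hin hsp hnt hidx0 hv hpointsRk'
    rw [hv, mul_zero, pow_zero] at hcard
    have hv0 : padicValNat p (Nat.card (AddCommGroup.primaryComponent (W.baseChange K).sha p)) = 0 := by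
      rw [padicValNat.eq_zero_iff]
      rcases Nat.le_one_iff_eq_zero_or_eq_one.mp hcard with h | h
      · exact Or.inr (Or.inl h)
      · exact Or.inr (Or.inr (by rw [h]; exact fun hd ↦ hp.one_lt.ne' (Nat.dvd_one.mp hd)))
    -- `t = 0`
    have ht : t = 0 := by
      by_contra ht0
      have hdiv1 : ∀ Q : geomPoints (W.baseChange K), ∃ R, ((p ^ 1 : ℕ) : ℤ) • R = Q := fun Q ↦
        (W.baseChange K).zsmul_geomPoints_surjective_holds (by exact_mod_cast pow_ne_zero 1 hp.ne_zero) Q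
      obtain ⟨ε, τ, hτ, A, hA, emb, Pt, hPt, -, -, -, hPt1, -, -, hm'⟩ := hpointsRk 0 le_rfl hdiv1 c hc
      have h1 := (hm' 1 squarefree_one (by simp)).2.2.2
      rw [show 1 - t = 0 by omega, pow_zero, one_smul] at h1
      have hP1 : toGeomPoints (W.baseChange K) P ∈
          KolyvaginCocycle.invPoints (Field.absoluteGaloisGroup K) (A 1) ((p ^ 1 : ℕ) : ℤ) := by
        rw [← hPt1]; exact hPt 1
      rw [kolyvaginClass_congr_point (hA 1) (hP' := hP1) hPt1, kolyvaginClass_toGeomPoints (hA 1) P hP1] at h1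
      have hker : P ∈ (kummerMapTorsion (W.baseChange K) _ hdiv1).ker := by
        rw [AddMonoidHom.mem_ker, h1]
      rw [kummerMapTorsion_ker, AddMonoidHom.mem_range] at hker
      obtain ⟨z, hz⟩ := hker
      exact hmax' ⟨z, hz⟩
    rw [hv, ht, hv0]
  have hx₀' : p ^ M₀ • x₀ = P := by rw [← natCast_zsmul]; exact hx₀
  have hmax : ∀ Q : (W.baseChange K).toAffine.Point, p ^ (M₀ + 1) • Q ≠ P := fun Q hQ ↦
    hmax' ⟨Q, by rw [natCast_zsmul]; exact hQ⟩
  rw [hv]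
  exact (card_sha_primary_le_of_ringClassRationalPointsMDiv_shift_of_poitouTate_of_localDuality_ofImage hPT W hN hp
    hp2 hIz hIs hIc hIt hK ι hin hsp hnt hpos hc hcc hx₀' hmax t hpointsRk e hμ hadd₁ hadd₂ hgal halt hnondeg inv hPT'
    hinv hH3 hB hPτ).2.2.2

end Summit.BirchSwinnertonDyer.BirchSwinnertonDyer.Theorems.ShimuraKolyvaginOfImage

end
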